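import Summits.NavierStokesRegularity.FunctionalMining.NoGo.TopEigHeatInverseGap
import HarnessLib

/-!
# FunctionalMining / NoGo — K66: WEIGHTED and ENERGY-NORMALISED GAP PINCH on everywhere-simple fields of `T³`
# `Φ₁(v)² ≤ 3 (∫ ‖v‖²/(qλ₁^{q−1}(λ₁ − λ₂))) · heatDissipation Φ_q v`, hence
# `(min_x qλ₁^{q−1}(λ₁ − λ₂)) · Φ₁(v)² ≤ 3 ‖v‖_{L²}² · heatDissipation Φ_q v`, every real `q ≥ 1`

HONEST FRAMING. Search for candidate a priori estimates; no regularity claim. Nothing about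
Navier–Stokes is proved or asserted in this file. Cell `pub-nsfunc`, no-go seat (gen 54). Door (e) box
of `NOGO.md` (STRUCTURE ONLY): a constraint on the SHAPE of a killing family for the open node
Lemma L-λ(q) = `TopEigHeatCoercivePos q` (door (b)/(F2) wants `¬ TopEigHeatCoercivePos q`: smooth
divergence-free `v_n` on `T³` with `heatDissipation Φ_q v_n ≤ c_n Φ_q(v_n)`, `c_n → 0`;
`Φ_q = torusTopEigMoment q = ∫ (λ₁⁺)^q`, `λ₁ ≥ λ₂ ≥ λ₃` the strain eigenvalues).
SETTING (as in K65 `NoGo.TopEigHeatInverseGap`). `v` smooth, divergence free on `T³`, top strain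
eigenvalue SIMPLE AT EVERY POINT; `P₁ = topProj v`; `|∇P₁|² = Σₖᵢⱼ (∂ₖ(P₁)ᵢⱼ)²`; gap weight
`w_q = qλ₁^{q−1}(λ₁ − λ₂)`; ENERGY `E(v) = ∫ ‖v‖²` (twice the kinetic energy).
CONTENT. K65 traded the transport identity `∫ λ₁ = −∫ v · div P₁` against `‖v‖_∞` and obtained the
harmonic-mean rule `Φ₁² ≤ 3‖v‖_∞² · heat · ∫ w_q⁻¹`. This file proves the MASTER WEIGHTED RULE behind it
and its ENERGY endpoint:
§ 1 **`topEigMoment_one_le_integral_norm_mul_sqrt`**: `Φ₁(v) ≤ √3 ∫ ‖v‖·|∇P₁|` (transport bound);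
**`topEigMoment_one_le_sqrt_energy`** / **`topEigMoment_one_sq_le_energy`**: `Φ₁(v)² ≤ 3 E(v) ∫ |∇P₁|²`.
§ 2 **`mul_integral_le_heatDissipation_of_le_weight`** (`q ≥ 1`): `m ≤ w_q` everywhere ⇒
`m ∫ |∇P₁|² ≤ heatDissipation Φ_q v` (K65 § 4; `0 ≤ heat` is the tree's `heatDissipation_nonneg_of_admissible`).
§ 3 **`mul_topEigMoment_one_sq_le_energy_of_le_weight`** (ENERGY PINCH, `q ≥ 1`): `m ≤ w_q` everywhere ⇒
`m · Φ₁(v)² ≤ 3 E(v) · heatDissipation Φ_q v`; the weight attains its minimum at a point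
(`exists_forall_weight_le`), so **`exists_weight_mul_topEigMoment_one_sq_le`**:
`∃ x₀, w_q(x₀) · Φ₁(v)² ≤ 3 E(v) · heat`.
§ 4 KILL RULE (R14′) **`exists_weight_mul_topEigMoment_one_sq_le_of_heat_le`**: `heat ≤ c Φ_q(v)` ⇒
`∃ x₀, qλ₁(x₀)^{q−1}(λ₁(x₀) − λ₂(x₀)) · Φ₁(v)² ≤ 3 E(v) · c Φ_q(v)` — along an everywhere-simple
killing family for L-λ(q), any real `q ≥ 1`, the gap weight must PINCH AT SOME POINT at the rate
`min w_q ≤ 3 c_n E(v_n) Φ_q(v_n)/Φ₁(v_n)²`, with only the energy as normalisation (no `‖v‖_∞`).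
§ 5 MASTER RULE **`topEigMoment_one_sq_le_integral_norm_sq_div_weight`** (`q ≥ 1`):
`Φ₁(v)² ≤ 3 (∫ ‖v‖²/w_q) · heatDissipation Φ_q v` (Cauchy–Schwarz with the weight split
`‖v‖|∇P₁| = ‖v‖w_q^{-1/2} · w_q^{1/2}|∇P₁|`), and KILL RULE (R14″)
**`topEigMoment_one_sq_le_integral_norm_sq_div_weight_of_heat_le`**: `heat ≤ c Φ_q(v)` ⇒
`Φ₁(v)² ≤ 3c Φ_q(v) ∫ ‖v‖²/w_q` — the `‖v‖²`-WEIGHTED INVERSE GAP must blow up: the gap has to close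
WHERE THE FIELD IS LARGE, in `‖v‖²dx`-measure.
MEANING. (R14) (K65) and (R14′) are the two Hölder endpoints of (R14″) (`∫‖v‖²/w_q ≤ ‖v‖_∞² ∫ w_q⁻¹`,
resp. `≤ E(v)/min w_q`): sup-norm amplitude buys an integrated (harmonic-mean) gap condition, energy
buys a pointwise pinch, and (R14″) localises the pinch to the support of the energy.
NOT CLAIMED: fields with eigenvalue crossings (door-(e)
seam designs are not everywhere simple); any sign of `heatDissipation`
beyond the everywhere-simple case; any verdict on L-λ(q): OPEN in the kernel for every real `q > 1`;
(F2) WANTED/OPEN; no node decided. [ours = §§ 1–5 as stated; folklore = Cauchy–Schwarz, minimum of a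
continuous function on a compact space — via Mathlib]
FILING (prove seat g30, REQUEST #95): declarations byte-identical to the no-go seat's staged `TopEigHeatGapPinch.STAGING.lean` 84064f209768794c; this line is the only addition.
-/

noncomputable section

open Filter Topology Matrix Finset MeasureTheory
open scoped ContDiff

namespace Summit.NavierStokesRegularity.FunctionalMining

open Literature.Analysis Literature.Analysis.FunctionSpaces Literature.Analysis.FunctionSpaces.Torus
  SharpClass.DirectorForm Literature.Analysis.Matrix

namespace TopEig.InverseGap

variable {v : UnitAddTorus (Fin 3) → EuclideanSpace ℝ (Fin 3)} {q : ℝ}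

/-- **§ 1 transport bound `Φ₁(v) ≤ √3 ∫ ‖v‖·|∇P₁|`** on everywhere-simple smooth divergence-free `v` (K65 § 2:
`∫λ₁ = −∫ v·div P₁` and `|v·div P₁| ≤ √3‖v‖|∇P₁|` pointwise). [ours] -/
theorem topEigMoment_one_le_integral_norm_mul_sqrt (hv : Torus.IsSmooth v) (hdiv : Torus.IsDivFree v)
    (hsimple : ∀ x : UnitAddTorus (Fin 3), torusStrainMidEig v x < torusStrainTopEig v x) :
    torusTopEigMoment 1 v ≤ Real.sqrt 3 * ∫ x, ‖v x‖ *
      Real.sqrt (∑ k, ∑ i, ∑ j, Torus.partialDeriv k (fun y => topProj v y i j) x ^ 2) := by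
  have hP : ∀ i j, Torus.IsSmooth (fun y => topProj v y i j) := isSmooth_topProj_entry hv hsimple
  have hT : Continuous fun x =>
      ∑ j, v x j * ∑ i, Torus.partialDeriv i (fun y => topProj v y i j) x :=
    continuous_finsetSum _ fun j _ => (hv.apply j).continuous.mul
      (continuous_finsetSum _ fun i _ => ((hP i j).partialDeriv i).continuous)
  have hn : Continuous fun x => ‖v x‖ := hv.continuous.norm
  have hs := (continuous_sum_sq_partialDeriv_topProj hv hsimple).sqrt
  rw [FrameSpread.topEigMoment_one_eq_integral hv hdiv,
    integral_topEig_eq_neg_integral_transport hv hsimple, ← integral_const_mul]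
  exact (neg_le_abs _).trans (abs_integral_le_integral_abs.trans
    (integral_mono hT.integrable_unitAddTorus.abs ((hn.mul hs).const_mul _).integrable_unitAddTorus
      fun x => (abs_transport_topProj_le (v := v) x).trans_eq (by show _ = _; ring)))

/-- **§ 1 `Φ₁(v) ≤ √3 · √(∫‖v‖²) · √(∫|∇P₁|²)`** for everywhere-simple smooth divergence-free `v` on `T³`
(the transport bound and Cauchy–Schwarz in `L²`). [ours] -/
theorem topEigMoment_one_le_sqrt_energy (hv : Torus.IsSmooth v) (hdiv : Torus.IsDivFree v)
    (hsimple : ∀ x : UnitAddTorus (Fin 3), torusStrainMidEig v x < torusStrainTopEig v x) :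
    torusTopEigMoment 1 v ≤ Real.sqrt 3 * Real.sqrt (∫ x, ‖v x‖ ^ 2) *
      Real.sqrt (∫ x, ∑ k, ∑ i, ∑ j, Torus.partialDeriv k (fun y => topProj v y i j) x ^ 2) := by
  set G : UnitAddTorus (Fin 3) → ℝ := fun x =>
    ∑ k, ∑ i, ∑ j, Torus.partialDeriv k (fun y => topProj v y i j) x ^ 2 with hG
  have hG0 : ∀ x, 0 ≤ G x := fun x => Finset.sum_nonneg fun k _ => Finset.sum_nonneg fun i _ =>
    Finset.sum_nonneg fun j _ => sq_nonneg _
  have hn : Continuous fun x => ‖v x‖ := hv.continuous.norm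
  have hs : Continuous fun x => Real.sqrt (G x) := (continuous_sum_sq_partialDeriv_topProj hv hsimple).sqrt
  -- Hölder (2,2) for the nonnegative continuous functions `‖v‖` and `√G`
  have hH := integral_mul_le_Lp_mul_Lq_of_nonneg Real.HolderConjugate.two_two
    (ae_of_all _ fun x => norm_nonneg (v x)) (ae_of_all _ fun x => Real.sqrt_nonneg (G x))
    (hn.memLp_of_hasCompactSupport (μ := volume) (HasCompactSupport.of_compactSpace _))
    (hs.memLp_of_hasCompactSupport (μ := volume) (HasCompactSupport.of_compactSpace _))
  have e1 : ∫ x, ‖v x‖ ^ (2:ℝ) = ∫ x, ‖v x‖ ^ 2 :=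
    integral_congr_ae (ae_of_all _ fun x => by simp only [Real.rpow_two])
  have e2 : ∫ x, Real.sqrt (G x) ^ (2:ℝ) = ∫ x, G x :=
    integral_congr_ae (ae_of_all _ fun x => by simp only [Real.rpow_two, Real.sq_sqrt (hG0 x)])
  rw [e1, e2, ← Real.sqrt_eq_rpow, ← Real.sqrt_eq_rpow] at hH
  refine (topEigMoment_one_le_integral_norm_mul_sqrt hv hdiv hsimple).trans ?_
  rw [mul_assoc]
  exact mul_le_mul_of_nonneg_left hH (Real.sqrt_nonneg _)

/-- **§ 1 `Φ₁(v)² ≤ 3 (∫‖v‖²) ∫|∇P₁|²`** (squared form; `Φ₁ ≥ 0`). [ours] -/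
theorem topEigMoment_one_sq_le_energy (hv : Torus.IsSmooth v) (hdiv : Torus.IsDivFree v)
    (hsimple : ∀ x : UnitAddTorus (Fin 3), torusStrainMidEig v x < torusStrainTopEig v x) :
    torusTopEigMoment 1 v ^ 2 ≤ 3 * (∫ x, ‖v x‖ ^ 2) *
      ∫ x, ∑ k, ∑ i, ∑ j, Torus.partialDeriv k (fun y => topProj v y i j) x ^ 2 := by
  have hΦ0 : 0 ≤ torusTopEigMoment 1 v :=
    integral_nonneg fun x => Real.rpow_nonneg (le_max_right _ _) _
  have hE0 : 0 ≤ ∫ x, ‖v x‖ ^ 2 := integral_nonneg fun x => sq_nonneg _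
  have hG0 : 0 ≤ ∫ x, ∑ k, ∑ i, ∑ j, Torus.partialDeriv k (fun y => topProj v y i j) x ^ 2 :=
    integral_nonneg fun x => Finset.sum_nonneg fun k _ => Finset.sum_nonneg fun i _ =>
      Finset.sum_nonneg fun j _ => sq_nonneg _
  calc torusTopEigMoment 1 v ^ 2
      ≤ (Real.sqrt 3 * Real.sqrt (∫ x, ‖v x‖ ^ 2) * Real.sqrt
          (∫ x, ∑ k, ∑ i, ∑ j, Torus.partialDeriv k (fun y => topProj v y i j) x ^ 2)) ^ 2 :=
        pow_le_pow_left₀ hΦ0 (topEigMoment_one_le_sqrt_energy hv hdiv hsimple) 2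
    _ = _ := by
        rw [mul_pow, mul_pow, Real.sq_sqrt (by norm_num : (0:ℝ) ≤ 3), Real.sq_sqrt hE0, Real.sq_sqrt hG0]

/-- **§ 2** If `m ≤ w_q = qλ₁^{q−1}(λ₁ − λ₂)` everywhere (`q ≥ 1`), then `m ∫|∇P₁|² ≤ heatDissipation Φ_q v`
(K65 § 4 `integral_weight_mul_le_heatDissipation`). [ours, bookkeeping] -/
theorem mul_integral_le_heatDissipation_of_le_weight (hq : 1 ≤ q) (hv : Torus.IsSmooth v)
    (hdiv : Torus.IsDivFree v)
    (hsimple : ∀ x : UnitAddTorus (Fin 3), torusStrainMidEig v x < torusStrainTopEig v x) {m : ℝ}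
    (hm : ∀ x, m ≤ q * torusStrainTopEig v x ^ (q - 1) *
      (torusStrainTopEig v x - torusStrainMidEig v x)) :
    m * ∫ x, ∑ k, ∑ i, ∑ j, Torus.partialDeriv k (fun y => topProj v y i j) x ^ 2 ≤
      heatDissipation (torusTopEigMoment q) v := by
  have hGc := continuous_sum_sq_partialDeriv_topProj hv hsimple
  have hG0 : ∀ x, 0 ≤ ∑ k, ∑ i, ∑ j, Torus.partialDeriv k (fun y => topProj v y i j) x ^ 2 :=
    fun x => Finset.sum_nonneg fun k _ => Finset.sum_nonneg fun i _ =>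
      Finset.sum_nonneg fun j _ => sq_nonneg _
  rw [← integral_const_mul]
  refine (integral_mono (hGc.const_mul _).integrable_unitAddTorus
    (((continuous_strainGapWeight hq hv).mul hGc).integrable_unitAddTorus)
    fun x => mul_le_mul_of_nonneg_right (hm x) (hG0 x)).trans
    (integral_weight_mul_le_heatDissipation hq hv hdiv hsimple)

/-- **§ 3 ENERGY PINCH `m · Φ₁(v)² ≤ 3 (∫‖v‖²) · heatDissipation Φ_q v`** whenever `m ≤ w_q` everywhere
(`q ≥ 1`, everywhere simple; for `m ≤ 0` the left side is `≤ 0 ≤` the right side). [ours] -/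
theorem mul_topEigMoment_one_sq_le_energy_of_le_weight (hq : 1 ≤ q) (hv : Torus.IsSmooth v)
    (hdiv : Torus.IsDivFree v)
    (hsimple : ∀ x : UnitAddTorus (Fin 3), torusStrainMidEig v x < torusStrainTopEig v x) {m : ℝ}
    (hm : ∀ x, m ≤ q * torusStrainTopEig v x ^ (q - 1) *
      (torusStrainTopEig v x - torusStrainMidEig v x)) :
    m * torusTopEigMoment 1 v ^ 2 ≤
      3 * (∫ x, ‖v x‖ ^ 2) * heatDissipation (torusTopEigMoment q) v := by
  have hE0 : 0 ≤ ∫ x, ‖v x‖ ^ 2 := integral_nonneg fun x => sq_nonneg _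
  have hheat : 0 ≤ heatDissipation (torusTopEigMoment q) v :=   -- tree `TopEigHeatStable`
    heatDissipation_nonneg_of_admissible hq convexOn_lam lipschitzWith_lam
      (fun _ hw hdw x => lam_strainFlat_nonneg hw hdw x) (fun _ hw hdw => torusTopEigMoment_eq hw hdw q) hv hdiv
  rcases le_or_gt m 0 with hm0 | hm0
  · exact (mul_nonpos_of_nonpos_of_nonneg hm0 (sq_nonneg _)).trans (by positivity)
  calc m * torusTopEigMoment 1 v ^ 2
      ≤ m * (3 * (∫ x, ‖v x‖ ^ 2) *
          ∫ x, ∑ k, ∑ i, ∑ j, Torus.partialDeriv k (fun y => topProj v y i j) x ^ 2) :=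
        mul_le_mul_of_nonneg_left (topEigMoment_one_sq_le_energy hv hdiv hsimple) hm0.le
    _ = 3 * (∫ x, ‖v x‖ ^ 2) *
          (m * ∫ x, ∑ k, ∑ i, ∑ j, Torus.partialDeriv k (fun y => topProj v y i j) x ^ 2) := by ring
    _ ≤ _ := mul_le_mul_of_nonneg_left
          (mul_integral_le_heatDissipation_of_le_weight hq hv hdiv hsimple hm) (by positivity)

/-- The gap weight attains its minimum on the compact torus (`q ≥ 1`). [folklore] -/
theorem exists_forall_weight_le (hq : 1 ≤ q) (hv : Torus.IsSmooth v) :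
    ∃ x₀ : UnitAddTorus (Fin 3), ∀ x,
      q * torusStrainTopEig v x₀ ^ (q - 1) * (torusStrainTopEig v x₀ - torusStrainMidEig v x₀) ≤
        q * torusStrainTopEig v x ^ (q - 1) * (torusStrainTopEig v x - torusStrainMidEig v x) := by
  obtain ⟨x₀, -, hx₀⟩ := isCompact_univ.exists_isMinOn Set.univ_nonempty
    (continuous_strainGapWeight hq hv).continuousOn
  exact ⟨x₀, fun x => hx₀ (Set.mem_univ x)⟩

/-- **§ 3 `∃ x₀, w_q(x₀) · Φ₁(v)² ≤ 3 (∫‖v‖²) · heatDissipation Φ_q v`** (`q ≥ 1`, everywhere simple):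
the pinch happens AT A POINT. [ours] -/
theorem exists_weight_mul_topEigMoment_one_sq_le (hq : 1 ≤ q) (hv : Torus.IsSmooth v)
    (hdiv : Torus.IsDivFree v)
    (hsimple : ∀ x : UnitAddTorus (Fin 3), torusStrainMidEig v x < torusStrainTopEig v x) :
    ∃ x₀ : UnitAddTorus (Fin 3), q * torusStrainTopEig v x₀ ^ (q - 1) *
        (torusStrainTopEig v x₀ - torusStrainMidEig v x₀) * torusTopEigMoment 1 v ^ 2 ≤
      3 * (∫ x, ‖v x‖ ^ 2) * heatDissipation (torusTopEigMoment q) v := by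
  obtain ⟨x₀, hx₀⟩ := exists_forall_weight_le (v := v) hq hv
  exact ⟨x₀, mul_topEigMoment_one_sq_le_energy_of_le_weight hq hv hdiv hsimple hx₀⟩

/-- **§ 4 KILL RULE (R14′), energy-normalised pointwise gap pinch.** If
`heatDissipation Φ_q v ≤ c Φ_q(v)` for an everywhere-simple smooth divergence-free `v` on `T³`
(`q ≥ 1`), then at some point `x₀`:
`qλ₁(x₀)^{q−1}(λ₁(x₀) − λ₂(x₀)) · Φ₁(v)² ≤ 3 (∫‖v‖²) · c Φ_q(v)`. [ours] -/
theorem exists_weight_mul_topEigMoment_one_sq_le_of_heat_le (hq : 1 ≤ q) (hv : Torus.IsSmooth v)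
    (hdiv : Torus.IsDivFree v)
    (hsimple : ∀ x : UnitAddTorus (Fin 3), torusStrainMidEig v x < torusStrainTopEig v x) {c : ℝ}
    (hc : heatDissipation (torusTopEigMoment q) v ≤ c * torusTopEigMoment q v) :
    ∃ x₀ : UnitAddTorus (Fin 3), q * torusStrainTopEig v x₀ ^ (q - 1) *
        (torusStrainTopEig v x₀ - torusStrainMidEig v x₀) * torusTopEigMoment 1 v ^ 2 ≤
      3 * (∫ x, ‖v x‖ ^ 2) * (c * torusTopEigMoment q v) := by
  obtain ⟨x₀, hx₀⟩ := exists_weight_mul_topEigMoment_one_sq_le hq hv hdiv hsimple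
  exact ⟨x₀, hx₀.trans (mul_le_mul_of_nonneg_left hc (by positivity))⟩

/-- **§ 4 KILL RULE (R14′), `m`-form.** `heat ≤ cΦ_q(v)` and `m ≤ w_q` everywhere ⇒
`m · Φ₁(v)² ≤ 3 (∫‖v‖²) · c Φ_q(v)`. [ours, bookkeeping] -/
theorem mul_topEigMoment_one_sq_le_of_heat_le_of_le_weight (hq : 1 ≤ q) (hv : Torus.IsSmooth v)
    (hdiv : Torus.IsDivFree v)
    (hsimple : ∀ x : UnitAddTorus (Fin 3), torusStrainMidEig v x < torusStrainTopEig v x) {m c : ℝ}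
    (hm : ∀ x, m ≤ q * torusStrainTopEig v x ^ (q - 1) *
      (torusStrainTopEig v x - torusStrainMidEig v x))
    (hc : heatDissipation (torusTopEigMoment q) v ≤ c * torusTopEigMoment q v) :
    m * torusTopEigMoment 1 v ^ 2 ≤ 3 * (∫ x, ‖v x‖ ^ 2) * (c * torusTopEigMoment q v) :=
  (mul_topEigMoment_one_sq_le_energy_of_le_weight hq hv hdiv hsimple hm).trans
    (mul_le_mul_of_nonneg_left hc (by positivity))

/-- **§ 5 MASTER WEIGHTED RULE `Φ₁(v)² ≤ 3 · (∫ ‖v‖²/w_q) · heatDissipation Φ_q v`** (`q ≥ 1`, everywhere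
simple, `w_q = qλ₁^{q−1}(λ₁ − λ₂) > 0`): split `‖v‖|∇P₁| = (‖v‖ w_q^{-1/2}) · (w_q^{1/2}|∇P₁|)` in the transport
bound, Cauchy–Schwarz, then K65 § 4 `∫ w_q|∇P₁|² ≤ heat`. K65's (R14) (`∫‖v‖²/w_q ≤ ‖v‖_∞² ∫ w_q⁻¹`) and § 3's
(R14′) (`∫‖v‖²/w_q ≤ (∫‖v‖²)/min w_q`) are its two Hölder endpoints. [ours] -/
theorem topEigMoment_one_sq_le_integral_norm_sq_div_weight (hq : 1 ≤ q) (hv : Torus.IsSmooth v)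
    (hdiv : Torus.IsDivFree v)
    (hsimple : ∀ x : UnitAddTorus (Fin 3), torusStrainMidEig v x < torusStrainTopEig v x) :
    torusTopEigMoment 1 v ^ 2 ≤ 3 * (∫ x, ‖v x‖ ^ 2 /
        (q * torusStrainTopEig v x ^ (q - 1) * (torusStrainTopEig v x - torusStrainMidEig v x))) *
      heatDissipation (torusTopEigMoment q) v := by
  set G : UnitAddTorus (Fin 3) → ℝ := fun x =>
    ∑ k, ∑ i, ∑ j, Torus.partialDeriv k (fun y => topProj v y i j) x ^ 2 with hG
  set w : UnitAddTorus (Fin 3) → ℝ := fun x =>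
    q * torusStrainTopEig v x ^ (q - 1) * (torusStrainTopEig v x - torusStrainMidEig v x) with hw
  have hG0 : ∀ x, 0 ≤ G x := fun x => Finset.sum_nonneg fun k _ => Finset.sum_nonneg fun i _ =>
    Finset.sum_nonneg fun j _ => sq_nonneg _
  have hwp : ∀ x, 0 < w x := strainGapWeight_pos (by linarith) hv hdiv hsimple
  have hwc : Continuous w := continuous_strainGapWeight hq hv
  have hGc : Continuous G := continuous_sum_sq_partialDeriv_topProj hv hsimple
  have hn : Continuous fun x => ‖v x‖ := hv.continuous.norm
  -- the two Cauchy–Schwarz factors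
  have hf : Continuous fun x => ‖v x‖ * Real.sqrt ((w x)⁻¹) :=
    hn.mul (continuous_inv_strainGapWeight hq hv hdiv hsimple).sqrt
  have hg : Continuous fun x => Real.sqrt (w x) * Real.sqrt (G x) := hwc.sqrt.mul hGc.sqrt
  have hH := integral_mul_le_Lp_mul_Lq_of_nonneg Real.HolderConjugate.two_two
    (ae_of_all _ fun x => mul_nonneg (norm_nonneg (v x)) (Real.sqrt_nonneg _))
    (ae_of_all _ fun x => mul_nonneg (Real.sqrt_nonneg (w x)) (Real.sqrt_nonneg (G x)))
    (hf.memLp_of_hasCompactSupport (μ := volume) (HasCompactSupport.of_compactSpace _))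
    (hg.memLp_of_hasCompactSupport (μ := volume) (HasCompactSupport.of_compactSpace _))
  have efg : ∀ x, ‖v x‖ * Real.sqrt ((w x)⁻¹) * (Real.sqrt (w x) * Real.sqrt (G x)) =
      ‖v x‖ * Real.sqrt (G x) := fun x => by
    have hsw : Real.sqrt ((w x)⁻¹) * Real.sqrt (w x) = 1 := by
      rw [Real.sqrt_inv, inv_mul_cancel₀ (Real.sqrt_ne_zero'.2 (hwp x))]
    calc _ = ‖v x‖ * (Real.sqrt ((w x)⁻¹) * Real.sqrt (w x)) * Real.sqrt (G x) := by ring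
      _ = _ := by rw [hsw, mul_one]
  have e1 : ∫ x, (‖v x‖ * Real.sqrt ((w x)⁻¹)) ^ (2:ℝ) = ∫ x, ‖v x‖ ^ 2 / w x :=
    integral_congr_ae (ae_of_all _ fun x => by
      simp only [Real.rpow_two, mul_pow, Real.sq_sqrt (inv_nonneg.2 (hwp x).le), div_eq_mul_inv])
  have e2 : ∫ x, (Real.sqrt (w x) * Real.sqrt (G x)) ^ (2:ℝ) = ∫ x, w x * G x :=
    integral_congr_ae (ae_of_all _ fun x => by
      simp only [Real.rpow_two, mul_pow, Real.sq_sqrt (hwp x).le, Real.sq_sqrt (hG0 x)])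
  simp_rw [efg] at hH
  rw [e1, e2, ← Real.sqrt_eq_rpow, ← Real.sqrt_eq_rpow] at hH
  -- `Φ₁ ≤ √3 · √(∫‖v‖²/w) · √(∫ w G)` and square
  have hΦ0 : 0 ≤ torusTopEigMoment 1 v :=
    integral_nonneg fun x => Real.rpow_nonneg (le_max_right _ _) _
  have hA0 : 0 ≤ ∫ x, ‖v x‖ ^ 2 / w x := integral_nonneg fun x => div_nonneg (sq_nonneg _) (hwp x).le
  have hB0 : 0 ≤ ∫ x, w x * G x := integral_nonneg fun x => mul_nonneg (hwp x).le (hG0 x)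
  have h1 : torusTopEigMoment 1 v ≤
      Real.sqrt 3 * (Real.sqrt (∫ x, ‖v x‖ ^ 2 / w x) * Real.sqrt (∫ x, w x * G x)) :=
    (topEigMoment_one_le_integral_norm_mul_sqrt hv hdiv hsimple).trans
      (mul_le_mul_of_nonneg_left hH (Real.sqrt_nonneg _))
  have hheat : ∫ x, w x * G x ≤ heatDissipation (torusTopEigMoment q) v :=
    integral_weight_mul_le_heatDissipation hq hv hdiv hsimple
  calc torusTopEigMoment 1 v ^ 2
      ≤ (Real.sqrt 3 * (Real.sqrt (∫ x, ‖v x‖ ^ 2 / w x) * Real.sqrt (∫ x, w x * G x))) ^ 2 :=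
        pow_le_pow_left₀ hΦ0 h1 2
    _ = 3 * (∫ x, ‖v x‖ ^ 2 / w x) * ∫ x, w x * G x := by
        rw [mul_pow, mul_pow, Real.sq_sqrt (by norm_num : (0:ℝ) ≤ 3), Real.sq_sqrt hA0, Real.sq_sqrt hB0,
          mul_assoc]
    _ ≤ 3 * (∫ x, ‖v x‖ ^ 2 / w x) * heatDissipation (torusTopEigMoment q) v :=
        mul_le_mul_of_nonneg_left hheat (by positivity)

/-- **§ 5 KILL RULE (R14″)** (`q ≥ 1`, everywhere simple): `heat ≤ c · Φ_q(v)` ⇒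
`Φ₁(v)² ≤ 3c · Φ_q(v) · ∫ ‖v‖²/(qλ₁^{q−1}(λ₁ − λ₂))` — the `‖v‖²`-WEIGHTED inverse gap must blow up along an
everywhere-simple killing family; (R14) and (R14′) are its corollaries. [ours] -/
theorem topEigMoment_one_sq_le_integral_norm_sq_div_weight_of_heat_le (hq : 1 ≤ q) (hv : Torus.IsSmooth v)
    (hdiv : Torus.IsDivFree v)
    (hsimple : ∀ x : UnitAddTorus (Fin 3), torusStrainMidEig v x < torusStrainTopEig v x) {c : ℝ}
    (hc : heatDissipation (torusTopEigMoment q) v ≤ c * torusTopEigMoment q v) :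
    torusTopEigMoment 1 v ^ 2 ≤ 3 * (∫ x, ‖v x‖ ^ 2 /
        (q * torusStrainTopEig v x ^ (q - 1) * (torusStrainTopEig v x - torusStrainMidEig v x))) *
      (c * torusTopEigMoment q v) :=
  (topEigMoment_one_sq_le_integral_norm_sq_div_weight hq hv hdiv hsimple).trans
    (mul_le_mul_of_nonneg_left hc (mul_nonneg (by norm_num) (integral_nonneg fun x =>
      div_nonneg (sq_nonneg _) (strainGapWeight_pos (by linarith) hv hdiv hsimple x).le)))


end TopEig.InverseGap

end Summit.NavierStokesRegularity.FunctionalMining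

end
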